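import Literature.MathematicalPhysics.QuantumFieldTheory.Balaban1983to89.FlowStepRuns
import Literature.MathematicalPhysics.QuantumFieldTheory.Balaban1983to89.BetaDerivClause

/-!
# `Balaban1983to89.BetaDerivClauseThm2` — BETA row an4, end-to-end by name: Theorem 2 (printed reading) from (AF-0) + the
k-uniform last-variable clause + coordinatewise Lipschitz + the printed upper bound

HONEST FRAMING (BETA-SPEC.md, verbatim): discharging `BetaPertH` makes Bałaban's UV stability UNCONDITIONAL — a real
constructive-QFT result; it is NOT the continuum limit and NOT the Clay problem.  THIS MODULE DISCHARGES NOTHING: it composes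
`BetaDerivClause` (p177185: the β-side clauses ⇒ (AF-1), (C)) with `FlowStepRuns.thm2Printed_of_splitH` (v1.4: (AF-0), (AF-1),
(C), (U) ⇒ `B12.Thm2Printed`) so that the cell's located gap (`HOME/BETA/AN4.md` §4: the unprinted inductive clause (1.18-∂) and
the one unperformed estimate (P1)) is, by name, ALL that separates the hypotheses below from print on the β side.  Value = typed
skeleton + located gap, NOT summit progress.

CITATION HEADER (lean-in-tree rule 2026-08-18).  Typed skeleton of T. Bałaban, *Renormalization group approach to lattice gauge
field theories. I*, Commun. Math. Phys. **109**, 249–301 (1987) [Balaban1987RG1]: Theorem 2 p. 259 [PDF 11] (typed as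
`B12.Thm2Printed` by the cell, `B12.lean`), the β-clause p. 264 [PDF 16] *"It is a smooth function defined on the interval [0, γ],
(or analytic), uniformly bounded on this interval together with all derivatives. We will investigate other properties in a
separate paper."*, and (2.13)–(2.15) p. 268 [PDF 20].  Every hypothesis of the theorem below that concerns β is UNPRINTED for
Bałaban's (1.22) except `hup` ((5.10)+(5.42), `FlowStepRuns.betaBoundsH_of_decay510`) and the one-loop split's vanishing
(p. 268 *"the expression under the exponential above vanishes at g_k = 0"*): (AF-0) is rows an1–an3's, `hD`/`hcoord` are row an4's
located clause (GAPS G-pv20-3).  Unit `b2b-balaban-pv20` (acting BETA-an4); Mathlib + the two imports only; no `sorry`/`axiom`.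
-/

namespace Literature.MathematicalPhysics.QuantumFieldTheory.Balaban1983to89.BetaDerivClauseThm2

open Literature.MathematicalPhysics.QuantumFieldTheory.Balaban1983to89
open Literature.MathematicalPhysics.QuantumFieldTheory.Balaban1983to89.FlowStep
open Literature.MathematicalPhysics.QuantumFieldTheory.Balaban1983to89.BetaDerivClause

/-- **Theorem 2 (printed reading `B12.Thm2Printed`) from the β-side clauses of row an4.**  For a forward-generated history family
`β` with printed one-loop split `S`: (AF-0) `2b ≤ β⁰_{k+1}`; the k-UNIFORM Lipschitz-at-zero clause in the last coupling with constant
`Cr`, `Cr·γ₀ ≤ b` (⇒ (AF-1), `BetaDerivClause.af1_of_atZero`); coordinatewise Lipschitz bounds per scale (⇒ (C),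
`BetaDerivClause.betaContH_of_coordLipschitz`); and the printed upper bound (U) — give `B12.Thm2Printed C L`.  Hypotheses only;
nothing of the series is asserted. [cite: Balaban1987RG1, Thm 2 p.259 and §1 p.264] -/
theorem thm2Printed_of_atZero {C : B12.Construction} {β : HBeta} (hgen : DagBinding.ForwardGenerated C β)
    (S : B12Beta.OneLoopSplit β) {L b Cr γ₀ β' : ℝ} (hL : 1 < L) (hγ₀ : 0 < γ₀) (hb : 0 < b)
    (hAF0 : ∀ k, 2 * b ≤ S.β0 k) (hZ : LastVarLipschitzAtZero β Cr γ₀) (hCr : 0 ≤ Cr) (hγ : Cr * γ₀ ≤ b)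
    (hcoord : ∀ k, ∃ C' : ℝ, 0 ≤ C' ∧ CoordLipschitzAt β k C' γ₀) (hup : BetaUpperH β' γ₀ β) :
    B12.Thm2Printed C L :=
  FlowStepRuns.thm2Printed_of_splitH hgen S hL hγ₀ hb hAF0 (af1_of_atZero S hZ) hCr hγ hup
    (betaContH_of_coordLipschitz hcoord)

/-- The same with the DERIVATIVE form of the clause (`|∂β_{k+1}/∂g_k| ≤ Cr` on `[0, γ₀]`, uniformly in the scale and the history —
the p. 264 words with the unprinted uniformity). [cite: Balaban1987RG1, Thm 2 p.259 and §1 p.264] -/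
theorem thm2Printed_of_derivClause {C : B12.Construction} {β : HBeta} (hgen : DagBinding.ForwardGenerated C β)
    (S : B12Beta.OneLoopSplit β) {L b Cr γ₀ β' : ℝ} (hL : 1 < L) (hγ₀ : 0 < γ₀) (hb : 0 < b)
    (hAF0 : ∀ k, 2 * b ≤ S.β0 k) (hD : LastVarDerivBound β Cr γ₀) (hCr : 0 ≤ Cr) (hγ : Cr * γ₀ ≤ b)
    (hcoord : ∀ k, ∃ C' : ℝ, 0 ≤ C' ∧ CoordLipschitzAt β k C' γ₀) (hup : BetaUpperH β' γ₀ β) :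
    B12.Thm2Printed C L :=
  thm2Printed_of_atZero hgen S hL hγ₀ hb hAF0 (atZero_of_lastVarLipschitz (lastVarLipschitz_of_derivBound hD)) hCr hγ
    hcoord hup

end Literature.MathematicalPhysics.QuantumFieldTheory.Balaban1983to89.BetaDerivClauseThm2
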